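import Summits.BirchSwinnertonDyer.Rank1Residual.X11b.Three.UnramifiedClassCuspLift
import HarnessLib

/-!
# Milne *ADT* I Prop. 3.8 in the kernel, part 2: Step 1 at a CUSP with the lift IN `E₀` — the Lang–Néron lift at a place of
# additive reduction returns a point of NONSINGULAR reduction
# (cell `bsd-stepL`, seat `bsd-stepL-corner3-p2` g10 = WIDTH-LEVER lane B; toward the DISCHARGE of the cite-only Literature fact
# `Milne2006_localTamagawaNumber_smul_unramifiedClass_eq_zero` (tam3-p1 g15, p614601); `--supports stmt-BirchSwinnertonDyer-21420 --as helper`)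

Companion of part 1 (`…MilneTamagawaLiftNode`, the node). x11b3-p8's `exists_lift_sub_mem_kernel_of_hasAdditiveReductionAt`
(`UnramifiedClassCuspLift`, p259017) constructs, at a place of ADDITIVE reduction and for `m ∈ E₀`, an `I_𝔐`-fixed `b` with
`m − (φ b − b) ∈ V₁` as a Hensel lift of a NONSINGULAR point of the cusp (Artin–Schreier "Lang" for `𝔾_a`, `exists_lift_forall_inertia`),
i.e. a point of `E₀`, but states only the existence of `b`. THIS FILE re-runs that proof VERBATIM and records the extra conjunct:
* `exists_lift_sub_mem_kernel_of_hasAdditiveReductionAt_mem_E0` — same hypotheses, conclusion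
  `∃ b, (I_𝔐 fixes b) ∧ b ∈ E₀ ∧ m − (φ b − b) ∈ V₁` («`E₀`» = `HasNonsingularReduction` on the `𝒪_w`-model `M.map ι` through
  `Affine.Point.congrEquiv (baseChange_map_eq_baseChange_map hι M)`, exactly as in the hypothesis `hm`).
WHY (discharge plan D of the Milne fact, STATUS 2026-08-28T08:2xZ): the located lifts give the LANG–NÉRON SURJECTIVITY
`E(K_v) ↠ (E(K_v^{nr})/E₀(K_v^{nr}))^{Frob}`, hence `#Φ̃^{Frob} = c_v`, the constant in Milne's statement. No mathematics beyond
x11b3-p8's (credit: x11b3-p8 `UnramifiedClassCuspLift`, p4 `GoodReductionSubgroupCusp*`, the tree's `GoodReductionLangLift`).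
HONEST FRAMING: one theorem; no definition, no named fact, no `sorry`; nothing about BSD, no stub closes, no item is credited (T7).
References: [cite: MilneADT2006, Ch. I Prop. 3.8 (proof)] [cite: SilvermanAEC2009, Prop. III.2.5(b), Prop. VII.2.1, Prop. VII.5.1(c)]
[cite: SerreLocalFields1979, X §1 (Artin–Schreier)].
-/

set_option linter.dupNamespace false
set_option autoImplicit false

noncomputable section

open scoped Classical NNReal
open NumberField IsDedekindDomain Field Polynomial ValuativeRel

universe u

namespace Summit.BirchSwinnertonDyer.BirchSwinnertonDyer.Theorems.MilneTamagawa

open WeierstrassCurve Literature.NumberTheory.EllipticCurves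
  Literature.NumberTheory.EllipticCurves.FormalGroupChart
  Literature.NumberTheory.GaloisRepresentations
  Literature.NumberTheory.GaloisRepresentations.IsNonarchimedeanLocalField IsDedekindDomain.HeightOneSpectrum
  Summit.BirchSwinnertonDyer.Rank1Residual.X11b.Three.JetchevKummer
  Summit.BirchSwinnertonDyer.Rank1Residual.X11b.Three.UnramifiedNode

section Model

variable {K : Type u} [Field K] [NumberField K] {v : HeightOneSpectrum (𝓞 K)}
  {w : Valuation (AlgebraicClosure (v.adicCompletion K)) ℝ≥0}
  (hw : ∀ x, (w x : ℝ) = spectralNorm (v.adicCompletion K) (AlgebraicClosure (v.adicCompletion K)) x)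
  {ι : v.adicCompletionIntegers K →+* w.integer}
  (hι : ∀ a, ((ι a : w.integer) : AlgebraicClosure (v.adicCompletion K)) =
    algebraMap (v.adicCompletion K) (AlgebraicClosure (v.adicCompletion K)) (a : v.adicCompletion K))


/-! ### Step 1 of Milne's proof at a cusp: the inertia-invariant Frobenius lift, located in `E₀` -/

include hw hι in
set_option maxHeartbeats 1600000 in
/-- **Milne ADT I.3.8, Step 1 at a place of ADDITIVE reduction, with the lift LOCATED IN `E₀`.** Let `E/K` have additive
reduction at `v`, `M = W.localMinimalIntegralModel v`, `V = M ⊗ K̄_v`, `W₀ = M.map ι` its `𝒪_w`-model, `𝔐` the prime of `\bar 𝓞_v`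
above `𝓂_v` with inertia group `I_𝔐 ≤ Γ_{K_v}`, and `φ ∈ Γ_{K_v}` inducing the `q_v`-power map on residues. Then for every
`m ∈ V(K̄_v)` with NONSINGULAR reduction on `W₀` there is `b ∈ V(K̄_v)` FIXED BY `I_𝔐`, WITH NONSINGULAR REDUCTION on `W₀`, and
with `m - (φ b - b) ∈ V₁(K̄_v)`. x11b3-p8's `exists_lift_sub_mem_kernel_of_hasAdditiveReductionAt` (p259017) VERBATIM — cusp map
`r`, Artin–Schreier `β^{q_v} − β = r(m)`, the point of `Ẽ_ns` with value `β`, its `I_𝔐`-invariant Hensel lift `b`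
(`exists_lift_forall_inertia`), `r(m − (φ b − b)) = 0` — with the one extra conjunct that the proof already establishes (`b` reduces
to a nonsingular point of the cusp; in the trivial branch `b = O`). [cite: MilneADT2006, Ch. I Prop. 3.8 (proof)]
[cite: SilvermanAEC2009, Prop. III.2.5(b), Prop. VII.2.1, Prop. VII.5.1(c)] [cite: SerreLocalFields1979, X §1] -/
theorem exists_lift_sub_mem_kernel_of_hasAdditiveReductionAt_mem_E0 (W : WeierstrassCurve K) [W.IsElliptic]
    (hadd : W.HasAdditiveReductionAt v)
    {𝔐 : Ideal v.localAbsIntegers} (h𝔐 : 𝔐 ∈ v.localPrimesAbove)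
    [hV : (((W.localMinimalIntegralModel v).map
        (algebraMap (v.adicCompletionIntegers K) (v.adicCompletion K))).baseChange
        (AlgebraicClosure (v.adicCompletion K))).IsIntegral w.integer]
    {φ : absoluteGaloisGroup (v.adicCompletion K)}
    (hφq : ∀ z : AlgebraicClosure (v.adicCompletion K), w z ≤ 1 →
      w (absoluteGaloisGroup.toAlgEquiv (v.adicCompletion K) φ z -
        z ^ Nat.card (IsLocalRing.ResidueField (v.adicCompletionIntegers K))) < 1)
    (m : (((W.localMinimalIntegralModel v).map
        (algebraMap (v.adicCompletionIntegers K) (v.adicCompletion K))).baseChange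
        (AlgebraicClosure (v.adicCompletion K))).toAffine.Point)
    (hm : ((W.localMinimalIntegralModel v).map ι).HasNonsingularReduction
      (Affine.Point.congrEquiv (baseChange_map_eq_baseChange_map hι (W.localMinimalIntegralModel v)) m)) :
    ∃ b : (((W.localMinimalIntegralModel v).map
        (algebraMap (v.adicCompletionIntegers K) (v.adicCompletion K))).baseChange
        (AlgebraicClosure (v.adicCompletion K))).toAffine.Point,
      (∀ τ ∈ 𝔐.inertia (absoluteGaloisGroup (v.adicCompletion K)),
        WeierstrassCurve.Affine.Point.map (W' := (W.localMinimalIntegralModel v).map (algebraMap (v.adicCompletionIntegers K) (v.adicCompletion K))) ((absoluteGaloisGroup.toAlgEquiv (v.adicCompletion K) τ :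
          AlgebraicClosure (v.adicCompletion K) ≃ₐ[v.adicCompletion K] AlgebraicClosure (v.adicCompletion K)) :
          AlgebraicClosure (v.adicCompletion K) →ₐ[v.adicCompletion K] AlgebraicClosure (v.adicCompletion K)) b = b) ∧
      ((W.localMinimalIntegralModel v).map ι).HasNonsingularReduction
        (Affine.Point.congrEquiv (baseChange_map_eq_baseChange_map hι (W.localMinimalIntegralModel v)) b) ∧
      m - (WeierstrassCurve.Affine.Point.map (W' := (W.localMinimalIntegralModel v).map (algebraMap (v.adicCompletionIntegers K) (v.adicCompletion K))) ((absoluteGaloisGroup.toAlgEquiv (v.adicCompletion K) φ :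
          AlgebraicClosure (v.adicCompletion K) ≃ₐ[v.adicCompletion K] AlgebraicClosure (v.adicCompletion K)) :
          AlgebraicClosure (v.adicCompletion K) →ₐ[v.adicCompletion K] AlgebraicClosure (v.adicCompletion K)) b - b)
        ∈ FormalGroupChart.kernel w (((W.localMinimalIntegralModel v).map
            (algebraMap (v.adicCompletionIntegers K) (v.adicCompletion K))).baseChange
            (AlgebraicClosure (v.adicCompletion K))) := by
  have hvw : w.Integers w.integer := Valuation.integer.integers w
  have hφw : ∀ z, w (absoluteGaloisGroup.toAlgEquiv (v.adicCompletion K) φ z) = w z :=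
    fun z ↦ spectralValuation_smul hw φ z
  have hq2 := two_le_natCard_residueField (K := K) (v := v)
  haveI : IsAlgClosed (IsLocalRing.ResidueField w.integer) := isAlgClosed_residueField_integer w
  -- the curve `V` is elliptic
  haveI hVell : ((((W.localMinimalIntegralModel v).map (algebraMap (v.adicCompletionIntegers K) (v.adicCompletion K))).baseChange (AlgebraicClosure (v.adicCompletion K)))).IsElliptic := by
    haveI := W.isElliptic_localMinimalModel v
    have hM : (W.localMinimalIntegralModel v).map (algebraMap (v.adicCompletionIntegers K) (v.adicCompletion K)) = W.localMinimalModel v :=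
      baseChange_integralModel_eq (v.adicCompletionIntegers K) (W.localMinimalModel v)
    rw [hM]
    infer_instance
  have hX : ((W.localMinimalIntegralModel v).map (algebraMap (v.adicCompletionIntegers K) (v.adicCompletion K))).baseChange
      (AlgebraicClosure (v.adicCompletion K)) = ((W.localMinimalIntegralModel v).map ι).baseChange (AlgebraicClosure (v.adicCompletion K)) :=
    baseChange_map_eq_baseChange_map hι (W.localMinimalIntegralModel v)
  -- kernel membership is reduction to `O` on `W₀`
  have hker : ∀ P : (((W.localMinimalIntegralModel v).map (algebraMap (v.adicCompletionIntegers K) (v.adicCompletion K))).baseChange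
      (AlgebraicClosure (v.adicCompletion K))).toAffine.Point,
      ((W.localMinimalIntegralModel v).map ι).ReducesToZero (Affine.Point.congrEquiv hX P) ↔ P ∈ FormalGroupChart.kernel w
        (((W.localMinimalIntegralModel v).map (algebraMap (v.adicCompletionIntegers K) (v.adicCompletion K))).baseChange
          (AlgebraicClosure (v.adicCompletion K))) := by
    intro P
    rcases P with _ | ⟨x, y, h⟩
    · rw [← Affine.Point.zero_def, map_zero]
      exact iff_of_true WeierstrassCurve.reducesToZero_zero
        (fun he ↦ (Affine.Point.some_ne_zero _ he.symm).elim)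
    · rw [Affine.Point.congrEquiv_some, WeierstrassCurve.reducesToZero_some_iff,
        not_mem_range_iff hvw, FormalGroupChart.some_mem_kernel_iff]
  -- the presented cusp `W̃₀ = singularModel x₀ y₀ α α` and p4's cusp map `r`
  obtain ⟨x₀, y₀, α, hW⟩ :=
    exists_map_residue_eq_singularModel_cusp_of_hasAdditiveReductionAt hw hι hadd
  obtain ⟨r, hr0, hr⟩ := exists_addMonoidHom_of_map_eq_singularModel_cusp
    ((W.localMinimalIntegralModel v).map ι) hvw hW
  -- the residue map `φ̄` of the isometry `φ` (as in the tree's `NodeReductionGaloisProofs`)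
  let σR : w.integer →+* w.integer :=
    { toFun := fun a ↦ ⟨absoluteGaloisGroup.toAlgEquiv (v.adicCompletion K) φ a, by
        rw [Valuation.mem_integer_iff, hφw]; exact a.2⟩
      map_one' := Subtype.ext (by simp)
      map_mul' := fun a b ↦ Subtype.ext (by simp)
      map_zero' := Subtype.ext (by simp)
      map_add' := fun a b ↦ Subtype.ext (by simp) }
  have hσR : ∀ a : w.integer, (σR a : AlgebraicClosure (v.adicCompletion K)) =
      absoluteGaloisGroup.toAlgEquiv (v.adicCompletion K) φ a := fun _ ↦ rfl
  haveI : IsLocalHom σR := by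
    refine ⟨fun a ha ↦ ?_⟩
    rw [hvw.isUnit_iff_valuation_eq_one] at ha ⊢
    rw [← ha]
    exact (hφw a).symm
  let σk : IsLocalRing.ResidueField w.integer →+* IsLocalRing.ResidueField w.integer :=
    IsLocalRing.ResidueField.map σR
  have hσk : ∀ a : w.integer, σk (IsLocalRing.residue w.integer a) =
      IsLocalRing.residue w.integer (σR a) := fun a ↦ IsLocalRing.ResidueField.map_residue σR a
  -- `φ̄` is the `q`-power map
  have hσkq : ∀ x : IsLocalRing.ResidueField w.integer,
      σk x = x ^ Nat.card (IsLocalRing.ResidueField (v.adicCompletionIntegers K)) := by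
    intro x
    obtain ⟨z, rfl⟩ := IsLocalRing.residue_surjective x
    have hz : w (z : AlgebraicClosure (v.adicCompletion K)) ≤ 1 := z.2
    have hzq : w ((z : AlgebraicClosure (v.adicCompletion K)) ^
        Nat.card (IsLocalRing.ResidueField (v.adicCompletionIntegers K))) ≤ 1 := by
      rw [map_pow]; exact pow_le_one₀ zero_le hz
    rw [hσk]
    refine (WeierstrassCurve.residue_eq_of_val_sub_lt_one (w := w) hzq (σR z).2 (hφq _ hz)).trans ?_
    rw [← map_pow]
    exact congrArg _ (Subtype.ext (by simp))
  -- `φ̄` fixes the reduced equation, hence the cusp and its tangent slope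
  have hWσ : ((W.localMinimalIntegralModel v).map ι).map σR = (W.localMinimalIntegralModel v).map ι := by
    rw [WeierstrassCurve.map_map]
    congr 1
    ext c
    change absoluteGaloisGroup.toAlgEquiv (v.adicCompletion K) φ ((ι c : w.integer) : AlgebraicClosure (v.adicCompletion K)) = ι c
    rw [hι]
    exact AlgEquiv.commutes _ _
  have hWk : (singularModel x₀ y₀ α α).map σk = singularModel x₀ y₀ α α := by
    rw [← hW, WeierstrassCurve.map_map]
    change ((W.localMinimalIntegralModel v).map ι).map
      ((IsLocalRing.ResidueField.map σR).comp (IsLocalRing.residue w.integer)) = _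
    rw [IsLocalRing.ResidueField.map_comp_residue, ← WeierstrassCurve.map_map, hWσ]
  obtain ⟨hx₀, hy₀, hslopes⟩ := singularModel.apply_eq_of_map_eq hWk
  have hα : σk α = α := by rcases hslopes with ⟨h, -⟩ | ⟨h, -⟩ <;> exact h
  -- `m` in `E₀`, its value `a = r(m)`; trivial case `m ∈ V₁`
  have hmE : Affine.Point.congrEquiv hX m ∈ ((W.localMinimalIntegralModel v).map ι).nonsingularReductionSubgroup hvw := hm
  by_cases hrm : r ⟨_, hmE⟩ = 0
  · refine ⟨0, fun τ _ ↦ by rw [map_zero], by rw [map_zero]; exact hasNonsingularReduction_zero, ?_⟩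
    rw [map_zero, sub_self, sub_zero]
    exact (hker m).mp ((hr0 ⟨_, hmE⟩).mp hrm)
  -- Artin–Schreier: `β^q - β = a`
  obtain ⟨β, hβ⟩ := exists_pow_sub_self_eq hq2 (r ⟨_, hmE⟩)
  -- the point of `Ẽ_ns` with value `β`; it is not `Õ` since `a ≠ 0`
  obtain ⟨Q, hQ⟩ := singularModel.cuspHom_surjective (x₀ := x₀) (y₀ := y₀) (α := α) β
  rcases Q with _ | ⟨αQ, βQ, hnsQ⟩
  · exfalso
    rw [← Affine.Point.zero_def, map_zero] at hQ
    apply hrm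
    rw [← hβ, ← hQ, zero_pow (by omega), sub_zero]
  rw [singularModel.cuspHom_apply] at hQ
  -- the lift of `Q = (αQ, βQ)` to an `I_𝔐`-invariant `𝒪_w`-point `(a₁, b₁)` of `W₀`
  have hnsW : (((W.localMinimalIntegralModel v).map ι).map (IsLocalRing.residue w.integer)).toAffine.Nonsingular αQ βQ := by
    rw [hW]; exact hnsQ
  obtain ⟨a₁, b₁, hab, ha₁, hb₁, ha₁I, hb₁I⟩ :=
    exists_lift_forall_inertia hw hι h𝔐 (W.localMinimalIntegralModel v) hnsW
  have hL : (((W.localMinimalIntegralModel v).map (algebraMap (v.adicCompletionIntegers K) (v.adicCompletion K))).baseChange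
      (AlgebraicClosure (v.adicCompletion K))).toAffine.Nonsingular
      (a₁ : AlgebraicClosure (v.adicCompletion K)) (b₁ : AlgebraicClosure (v.adicCompletion K)) := by
    rw [← Affine.equation_iff_nonsingular, hX]
    exact (map_equation_iff hvw.hom_inj).mpr hab
  have hL' : (((W.localMinimalIntegralModel v).map ι).baseChange (AlgebraicClosure (v.adicCompletion K))).toAffine.Nonsingular
      (algebraMap w.integer (AlgebraicClosure (v.adicCompletion K)) a₁)
      (algebraMap w.integer (AlgebraicClosure (v.adicCompletion K)) b₁) := by
    have h := hL; rw [hX] at h; exact h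
  have hns_res : (singularModel x₀ y₀ α α).toAffine.Nonsingular (IsLocalRing.residue w.integer a₁)
      (IsLocalRing.residue w.integer b₁) := by
    rw [ha₁, hb₁]; exact hnsQ
  have hbE' : ∀ h', ((W.localMinimalIntegralModel v).map ι).HasNonsingularReduction
      (.some (algebraMap w.integer (AlgebraicClosure (v.adicCompletion K)) a₁)
        (algebraMap w.integer (AlgebraicClosure (v.adicCompletion K)) b₁) h') := fun h' ↦
    (hasNonsingularReduction_some_algebraMap_iff hvw.hom_inj h').mpr (by rw [hW]; exact hns_res)
  have hcongr : Affine.Point.congrEquiv hX (.some _ _ hL) = .some _ _ hL' := by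
    rw [Affine.Point.congrEquiv_some]; rfl
  have hbE : ((W.localMinimalIntegralModel v).map ι).HasNonsingularReduction (Affine.Point.congrEquiv hX (.some _ _ hL)) := by
    rw [hcongr]; exact hbE' _
  have hbEm : Affine.Point.congrEquiv hX (.some _ _ hL) ∈
      ((W.localMinimalIntegralModel v).map ι).nonsingularReductionSubgroup hvw := hbE
  -- `r(b) = β`
  have hrb : r ⟨_, hbEm⟩ = β := by
    have h1 : (⟨Affine.Point.congrEquiv hX (.some _ _ hL), hbEm⟩ :
        ((W.localMinimalIntegralModel v).map ι).nonsingularReductionSubgroup hvw) = ⟨.some _ _ hL', hbE' hL'⟩ :=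
      Subtype.ext hcongr
    rw [h1, hr a₁ b₁ hL' hns_res (hbE' hL')]
    have h2 : (WeierstrassCurve.Affine.Point.some _ _ hns_res :
        (singularModel x₀ y₀ α α).toAffine.Point) = .some αQ βQ hnsQ :=
      point_some_eq_some ha₁ hb₁
    rw [h2, hQ]
  -- the moved point `φ b = (φ a₁, φ b₁)`: in `E₀`, with `r(φ b) = β^q`
  have hσns : (singularModel x₀ y₀ α α).toAffine.Nonsingular
      (IsLocalRing.residue w.integer (σR a₁)) (IsLocalRing.residue w.integer (σR b₁)) := by
    have h := singularModel.nonsingular_map σk hnsQ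
    rw [hx₀, hy₀, hα] at h
    rw [← hσk, ← hσk, ha₁, hb₁]
    exact h
  have hab' : ((W.localMinimalIntegralModel v).map ι).toAffine.Equation (σR a₁) (σR b₁) := by
    have h : (((W.localMinimalIntegralModel v).map ι).map σR).toAffine.Equation (σR a₁) (σR b₁) :=
      (Affine.Equation.map σR hab : _)
    rwa [hWσ] at h
  have hφL : (((W.localMinimalIntegralModel v).map (algebraMap (v.adicCompletionIntegers K) (v.adicCompletion K))).baseChange
      (AlgebraicClosure (v.adicCompletion K))).toAffine.Nonsingular
      ((σR a₁ : w.integer) : AlgebraicClosure (v.adicCompletion K)) ((σR b₁ : w.integer) : AlgebraicClosure (v.adicCompletion K)) := by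
    rw [← Affine.equation_iff_nonsingular, hX]
    exact (map_equation_iff hvw.hom_inj).mpr hab'
  have hφL' : (((W.localMinimalIntegralModel v).map ι).baseChange (AlgebraicClosure (v.adicCompletion K))).toAffine.Nonsingular
      (algebraMap w.integer (AlgebraicClosure (v.adicCompletion K)) (σR a₁))
      (algebraMap w.integer (AlgebraicClosure (v.adicCompletion K)) (σR b₁)) := by
    have h := hφL; rw [hX] at h; exact h
  have hφbE' : ∀ h', ((W.localMinimalIntegralModel v).map ι).HasNonsingularReduction
      (.some (algebraMap w.integer (AlgebraicClosure (v.adicCompletion K)) (σR a₁))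
        (algebraMap w.integer (AlgebraicClosure (v.adicCompletion K)) (σR b₁)) h') := fun h' ↦
    (hasNonsingularReduction_some_algebraMap_iff hvw.hom_inj h').mpr (by rw [hW]; exact hσns)
  have hmap : WeierstrassCurve.Affine.Point.map (W' := (W.localMinimalIntegralModel v).map (algebraMap (v.adicCompletionIntegers K) (v.adicCompletion K)))
      ((absoluteGaloisGroup.toAlgEquiv (v.adicCompletion K) φ :
        AlgebraicClosure (v.adicCompletion K) ≃ₐ[v.adicCompletion K] AlgebraicClosure (v.adicCompletion K)) :
        AlgebraicClosure (v.adicCompletion K) →ₐ[v.adicCompletion K] AlgebraicClosure (v.adicCompletion K)) (.some _ _ hL) =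
      .some _ _ hφL := by
    rw [Affine.Point.map_some]; rfl
  have hφcongr : Affine.Point.congrEquiv hX (.some _ _ hφL) = .some _ _ hφL' := by
    rw [Affine.Point.congrEquiv_some]; rfl
  have hφbE : ((W.localMinimalIntegralModel v).map ι).HasNonsingularReduction
      (Affine.Point.congrEquiv hX (WeierstrassCurve.Affine.Point.map (W' := (W.localMinimalIntegralModel v).map (algebraMap (v.adicCompletionIntegers K) (v.adicCompletion K)))
        ((absoluteGaloisGroup.toAlgEquiv (v.adicCompletion K) φ :
          AlgebraicClosure (v.adicCompletion K) ≃ₐ[v.adicCompletion K] AlgebraicClosure (v.adicCompletion K)) :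
          AlgebraicClosure (v.adicCompletion K) →ₐ[v.adicCompletion K] AlgebraicClosure (v.adicCompletion K)) (.some _ _ hL))) := by
    rw [hmap, hφcongr]; exact hφbE' _
  have hφbEm : Affine.Point.congrEquiv hX (WeierstrassCurve.Affine.Point.map (W' := (W.localMinimalIntegralModel v).map (algebraMap (v.adicCompletionIntegers K) (v.adicCompletion K)))
        ((absoluteGaloisGroup.toAlgEquiv (v.adicCompletion K) φ :
          AlgebraicClosure (v.adicCompletion K) ≃ₐ[v.adicCompletion K] AlgebraicClosure (v.adicCompletion K)) :
          AlgebraicClosure (v.adicCompletion K) →ₐ[v.adicCompletion K] AlgebraicClosure (v.adicCompletion K)) (.some _ _ hL)) ∈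
      ((W.localMinimalIntegralModel v).map ι).nonsingularReductionSubgroup hvw := hφbE
  have hrφb : r ⟨_, hφbEm⟩ = β ^ Nat.card (IsLocalRing.ResidueField (v.adicCompletionIntegers K)) := by
    have h1 : (⟨_, hφbEm⟩ : ((W.localMinimalIntegralModel v).map ι).nonsingularReductionSubgroup hvw) =
        ⟨.some _ _ hφL', hφbE' hφL'⟩ := Subtype.ext ((congrArg _ hmap).trans hφcongr)
    rw [h1, hr (σR a₁) (σR b₁) hφL' hσns (hφbE' hφL'), ← hσkq, ← hQ]
    have hns' : (singularModel (σk x₀) (σk y₀) (σk α) (σk α)).toAffine.Nonsingular (σk αQ) (σk βQ) :=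
      singularModel.nonsingular_map σk hnsQ
    rw [← cuspFun_map_some σk hnsQ hns']
    -- both sides are `cuspFun` of the same coordinates for the same parameters
    have e1 : IsLocalRing.residue w.integer (σR a₁) = σk αQ := by rw [← hσk, ha₁]
    have e2 : IsLocalRing.residue w.integer (σR b₁) = σk βQ := by rw [← hσk, hb₁]
    simp only [singularModel.cuspFun, e1, e2, hx₀, hy₀, hα]
  -- `b` is fixed by `I_𝔐`
  refine ⟨.some _ _ hL, fun τ hτ ↦ ?_, hbE, ?_⟩
  · rw [Affine.Point.map_some]
    exact point_some_eq_some (ha₁I τ hτ) (hb₁I τ hτ)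
  -- `r(m - (φ b - b)) = a - (β^q - β) = 0`
  have key : r (⟨_, hmE⟩ - (⟨_, hφbEm⟩ - ⟨_, hbEm⟩)) = 0 := by
    rw [map_sub, map_sub, hrφb, hrb, ← hβ, sub_self]
  have hred := (hr0 _).mp key
  rw [← hker]
  simpa only [AddSubgroupClass.coe_sub, map_sub] using hred

end Model

end Summit.BirchSwinnertonDyer.BirchSwinnertonDyer.Theorems.MilneTamagawa

end
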